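import Summits.Parity.GeneralizedHardyLittlewood.Theorems.GreenTaoLevelTwoGITwoCyclicInverseBohrSize
import Mathlib.FieldTheory.Finite.Basic

/-!
# Route `GreenTaoLevelTwo`, crux `GITwo` (stmt-Parity-21275), line `birth`, stub `stub_cyclicInverse`:
# halving the frequency map in `ℤ/Nℤ`, `N` odd (the "`S₃ = ½·S`" step of GT08a arXiv Lemma 46)

Forty-ninth helper file toward the XL stub `stub_cyclicInverse` (B. Green, T. Tao, *An inverse
theorem for the Gowers `U³(G)` norm*, arXiv:math/0503014, Thm. 68 = PEMS 51 (2008) Thm. 12.8).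
The tree's Prop. 43/45/46 files carry the locally additive frequency map `μ = 2M` (the graph of
`2Γ'' − 2Γ''`); §9 Step 3 needs `M` itself (`2Mh·x = M(x+h)·(x+h) − Mx·x − Mh·h − {x,h}_M`,
`two_mul_pair_eq`) and the symmetry bound for `{x,z}_M`, which the paper obtains from the bound for
`μ` by passing to `B₃ = 2·B'₃`, `S₃ = ½·S` ("`{2x, z} = 2{x, z}`").  For `N` odd, `M := ((N+1)/2)·μ`
satisfies `2M = μ` exactly, inherits local additivity, and `{2x', z}_M = {x', z}_μ`; this def-free
file records these identities (with `M` spelled `fun v => c * μ v`, `2c = 1`).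

* `two_mul_half_eq_one` — `2 · ((N+1)/2) = 1` in `ℤ/Nℤ` for `N` odd;
* `half_additive` — `M(a+b) = M a + M b` wherever `μ(a+b) = μ a + μ b`;
* `antisym_half_two_mul` — `{2x', z}_M = {x', z}_μ` when `μ(x'+x') = μ x' + μ x'` and `2c = 1`;
* `norm_mul_half_eq` — `‖(2x')·ξ₃‖_{ℝ/ℤ} = ‖x'·(2ξ₃)‖_{ℝ/ℤ}` (Bohr sets in `S₃ = ½S` vs `S`).

References: [GreenTao2008U3Inverse] arXiv:math/0503014, Lemma 46 (last paragraph of the proof).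
-/

namespace Summit.Parity.GeneralizedHardyLittlewood.GreenTaoLevelTwoGITwoCyclicInverse

variable {N : ℕ}

/-- In `ℤ/Nℤ` with `N` odd, `c = (N+1)/2` satisfies `2c = 1`. [folklore] -/
theorem two_mul_half_eq_one (hN : Odd N) : (2 : ZMod N) * (((N + 1) / 2 : ℕ) : ZMod N) = 1 := by
  obtain ⟨k, hk⟩ := hN
  have h1 : (N + 1) / 2 = k + 1 := by omega
  rw [h1]
  have h2 : ((2 * (k + 1) : ℕ) : ZMod N) = ((N + 1 : ℕ) : ZMod N) := by
    congr 1; omega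
  have h3 : ((N + 1 : ℕ) : ZMod N) = 1 := by
    push_cast; rw [ZMod.natCast_self, zero_add]
  calc (2 : ZMod N) * ((k + 1 : ℕ) : ZMod N) = ((2 * (k + 1) : ℕ) : ZMod N) := by push_cast; ring
    _ = 1 := by rw [h2, h3]

/-- `M = c·μ` is additive wherever `μ` is. [folklore] -/
theorem half_additive (c : ZMod N) (μ : ZMod N → ZMod N) {a b : ZMod N}
    (h : μ (a + b) = μ a + μ b) : c * μ (a + b) = c * μ a + c * μ b := by
  rw [h, mul_add]

/-- **`{2x', z}_M = {x', z}_μ`**: with `M = c·μ`, `2c = 1` and `μ(x'+x') = μ x' + μ x'`,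
`M(2x')·z − M(z)·(2x') = μ(x')·z − μ(z)·x'` in `ℤ/Nℤ`.
[cite: GreenTao2008U3Inverse, Lemma 46 (proof, "`{2x,z} = 2{x,z}`")] -/
theorem antisym_half_two_mul (c : ZMod N) (hc : 2 * c = 1) (μ : ZMod N → ZMod N) {x' : ZMod N}
    (hμ : μ (x' + x') = μ x' + μ x') (z : ZMod N) :
    c * μ (x' + x') * z - c * μ z * (x' + x') = μ x' * z - μ z * x' := by
  rw [hμ]
  have h2 : μ x' + μ x' = 2 * μ x' := by ring
  have h3 : x' + x' = 2 * x' := by ring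
  rw [h2, h3]
  calc c * (2 * μ x') * z - c * μ z * (2 * x') = (2 * c) * (μ x' * z - μ z * x') := by ring
    _ = μ x' * z - μ z * x' := by rw [hc, one_mul]

/-- `2M = μ` pointwise for `M = c·μ`, `2c = 1`. [folklore] -/
theorem two_mul_half_apply (c : ZMod N) (hc : 2 * c = 1) (μ : ZMod N → ZMod N) (v : ZMod N) :
    2 * (c * μ v) = μ v := by
  rw [← mul_assoc, hc, one_mul]

/-- Bohr conditions for `2x'` against `ξ₃` are Bohr conditions for `x'` against `2ξ₃`
(`S₃ = ½·S ⇔ S = 2·S₃`). [folklore] -/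
theorem norm_two_mul_mul_eq [NeZero N] (x' ξ₃ : ZMod N) :
    ‖ZMod.toAddCircle ((x' + x') * ξ₃)‖ = ‖ZMod.toAddCircle (x' * (2 * ξ₃))‖ := by
  congr 2; ring

end Summit.Parity.GeneralizedHardyLittlewood.GreenTaoLevelTwoGITwoCyclicInverse
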